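import Literature.Claims.NS.Wu2026
import Literature.Analysis.FluidPDE.DivCurlLpEstimate
import Literature.Analysis.FluidPDE.VorticityCalculus
import Mathlib.Analysis.Calculus.BumpFunction.FiniteDimension
import Mathlib.Analysis.MeanInequalitiesPow
import HarnessLib

/-!
# C177 `Wu2026` — the local div–curl estimate: `∫_{B(c,r)} |∇V|^q ≤ C (∫_{B̄(c,r')} |curl V|^q +
# ∫_{B̄(c,r')} |V|^q)` for smooth divergence-free fields (tool for the gradient bounds (G1)/(G2) of
# `Step_construct`; cell `pub/ns-inputs`, seat `ns-in-wu-con`; route business of `GaldiLiouvilleGate`,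
# item stmt-NavierStokesRegularity-0897)

The local form of the Calderón–Zygmund div–curl inequality used in §3.2 of W. Wu,
arXiv:2608.22471v1 ((3.21)–(3.25) p.10–11, (3.33)–(3.34) p.13: «‖∇V_j‖_{L^{9/5}(K)} ≤
C(‖curl V_j‖_{L^{9/5}(K')} + ‖V_j‖_{L^{9/5}(K')})»): for `1 < q < ∞`, a centre `c` and radii
`0 < r < r'` there is a finite `C` such that every smooth divergence-free field `V` satisfies
`∫_{B(c,r)} |DV|^q ≤ C (∫_{B̄(c,r')} |curl V|^q + ∫_{B̄(c,r')} |V|^q)`. Proof: apply the tree's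
whole-space estimate `Literature.Analysis.FluidPDE.exists_eLpNorm_fderiv_le_curl_add_divergence`
(Majda–Bertozzi §4.2 / Prop. 10.6, PROVED in the tree by Calderón–Zygmund theory) to the truncation
`χV`, `χ` a bump equal to `1` on `B̄(c,r)` and supported in `B̄(c,r')`: `div(χV) = ⟪V, ∇χ⟫`,
`curl(χV) = χ curl V + ∇χ × V` (`divergence_smul_apply`, `curl_smul`), and `D(χV) = DV` on `B(c,r)`.

Theorems only, standard axioms, no `sorry`.

WHAT THIS IS NOT: not a proof of `Step_construct`; not a claim about NS regularity or blow-up; not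
a claim about any author beyond the typed locator.
-/

set_option linter.dupNamespace false

noncomputable section

open MeasureTheory Set Filter Topology Metric
open scoped ENNReal NNReal Topology RealInnerProductSpace

namespace Summit.NavierStokesRegularity.NavierStokesRegularity.Theorems.Wu2026Salvage

open Literature.Analysis.FluidPDE Literature.Analysis.FunctionSpaces Literature.Claims.NS.Wu2026

/-- `(∫⁻ ‖f‖ₑ^q)` from `eLpNorm` for a real exponent `1 < q`. [folklore] -/
theorem lintegral_rpow_enorm_eq_eLpNorm_rpow {F : Type*} [NormedAddCommGroup F] (f : E3 → F)
    (μ : Measure E3) {q : ℝ} (hq : 0 < q) :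
    ∫⁻ y, ‖f y‖ₑ ^ q ∂μ = eLpNorm f (ENNReal.ofReal q) μ ^ q := by
  have hq0 : ENNReal.ofReal q ≠ 0 := (ENNReal.ofReal_pos.2 hq).ne'
  rw [eLpNorm_eq_lintegral_rpow_enorm_toReal hq0 ENNReal.ofReal_ne_top, ENNReal.toReal_ofReal hq.le,
    ← ENNReal.rpow_mul, one_div_mul_cancel hq.ne', ENNReal.rpow_one]

/-- **Local div–curl estimate** (the local form of (3.21)/(3.33)–(3.34) p.10–13): for `1 < q`,
`c`, `0 < r < r'` there is `C < ∞` with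
`∫_{B(c,r)} |DV|^q ≤ C (∫_{B̄(c,r')} |curl V|^q + ∫_{B̄(c,r')} |V|^q)` for every smooth
divergence-free `V` (the tree's whole-space Calderón–Zygmund estimate applied to `χV`).
[cite: Wu2026, (3.21)–(3.25) p.10–11, (3.33)–(3.34) p.13] -/
theorem exists_local_gradient_bound {q : ℝ} (hq : 1 < q) (c : E3) {r r' : ℝ} (hr : 0 < r)
    (hrr' : r < r') :
    ∃ C : ℝ≥0∞, C ≠ ∞ ∧ ∀ V : E3 → E3, ContDiff ℝ (⊤ : ℕ∞) V → VectorCalculus.IsDivFree V →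
      ∫⁻ y in ball c r, ‖fderiv ℝ V y‖ₑ ^ q ≤
        C * ((∫⁻ y in closedBall c r', ‖curl V y‖ₑ ^ q) + ∫⁻ y in closedBall c r', ‖V y‖ₑ ^ q) := by
  have hq0 : 0 < q := by linarith
  have hq1 : 1 ≤ q := hq.le
  set p : ℝ≥0∞ := ENNReal.ofReal q with hp_def
  have hp1 : 1 < p := by rw [hp_def, ← ENNReal.ofReal_one]; exact (ENNReal.ofReal_lt_ofReal_iff hq0).2 hq
  have hptop : p < ⊤ := ENNReal.ofReal_lt_top
  obtain ⟨Ccz, hCcz⟩ := exists_eLpNorm_fderiv_le_curl_add_divergence hp1 hptop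
  -- the bump
  let χ : ContDiffBump c := ⟨r, r', hr, hrr'⟩
  have hχs : ContDiff ℝ (⊤ : ℕ∞) (χ : E3 → ℝ) := χ.contDiff
  have hχ1 : ContDiff ℝ 1 (χ : E3 → ℝ) := χ.contDiff
  have hχc : HasCompactSupport (χ : E3 → ℝ) := χ.hasCompactSupport
  have hχsupp : tsupport (χ : E3 → ℝ) = closedBall c r' := χ.tsupport_eq
  have hDχc : Continuous (fderiv ℝ (χ : E3 → ℝ)) := hχ1.continuous_fderiv one_ne_zero
  obtain ⟨Mχ, hMχ⟩ := hDχc.bounded_above_of_compact_support (hχc.fderiv (𝕜 := ℝ))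
  have hMχ0 : 0 ≤ Mχ := (norm_nonneg _).trans (hMχ c)
  set K : ℝ := ‖(curlCLM : (E3 →L[ℝ] E3) →L[ℝ] E3)‖ * Mχ with hK_def
  have hK0 : 0 ≤ K := by rw [hK_def]; positivity
  set S : Set E3 := closedBall c r' with hS_def
  have hSm : MeasurableSet S := measurableSet_closedBall
  -- the constant
  set A : ℝ≥0∞ := (2 : ℝ≥0∞) ^ (q - 1) * (1 + ENNReal.ofReal K ^ q) + ENNReal.ofReal Mχ ^ q with hA_def
  have h2top : (2 : ℝ≥0∞) ^ (q - 1) ≠ ∞ := ENNReal.rpow_ne_top_of_nonneg (by linarith) ENNReal.ofNat_ne_top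
  have hAtop : A ≠ ∞ := by
    refine ENNReal.add_ne_top.2 ⟨ENNReal.mul_ne_top h2top (ENNReal.add_ne_top.2 ⟨ENNReal.one_ne_top,
      ENNReal.rpow_ne_top_of_nonneg hq0.le ENNReal.ofReal_ne_top⟩),
      ENNReal.rpow_ne_top_of_nonneg hq0.le ENNReal.ofReal_ne_top⟩
  set C : ℝ≥0∞ := (Ccz : ℝ≥0∞) ^ q * (2 : ℝ≥0∞) ^ (q - 1) * A with hC_def
  have hCtop : C ≠ ∞ := ENNReal.mul_ne_top (ENNReal.mul_ne_top
    (ENNReal.rpow_ne_top_of_nonneg hq0.le ENNReal.coe_ne_top) h2top) hAtop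
  refine ⟨C, hCtop, fun V hV hdiv => ?_⟩
  have hV1 : ContDiff ℝ 1 V := hV.of_le (by norm_cast)
  have hVc : Continuous V := hV.continuous
  have hVd : ∀ x, DifferentiableAt ℝ V x := fun x => hV1.differentiable one_ne_zero x
  have hχd : ∀ x, DifferentiableAt ℝ (χ : E3 → ℝ) x := fun x => hχ1.differentiable one_ne_zero x
  have hcurlVc : Continuous (curl V) := continuous_curl hV1
  -- the truncated field
  set u : E3 → E3 := fun y => (χ : E3 → ℝ) y • V y with hu_def
  have hu : ContDiff ℝ (⊤ : ℕ∞) u := hχs.smul hV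
  have huc : HasCompactSupport u := hχc.smul_right
  have hcz := hCcz u hu huc
  -- abbreviations for the local integrals
  set Ic : ℝ≥0∞ := ∫⁻ y in S, ‖curl V y‖ₑ ^ q with hIc
  set IV : ℝ≥0∞ := ∫⁻ y in S, ‖V y‖ₑ ^ q with hIV
  -- pointwise: the curl of the truncation
  have hcurl_pt : ∀ x, ‖curl u x‖ₑ ≤ S.indicator (fun x => ‖curl V x‖ₑ + ENNReal.ofReal K * ‖V x‖ₑ) x := by
    intro x
    have hformula : curl u x = (χ : E3 → ℝ) x • curl V x +
        curlCLM ((fderiv ℝ (χ : E3 → ℝ) x).smulRight (V x)) := curl_smul (hχd x) (hVd x)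
    by_cases hx : x ∈ S
    · rw [indicator_of_mem hx, hformula]
      refine (enorm_add_le _ _).trans (add_le_add ?_ ?_)
      · rw [enorm_smul]
        calc ‖(χ : E3 → ℝ) x‖ₑ * ‖curl V x‖ₑ ≤ 1 * ‖curl V x‖ₑ := by
              gcongr
              rw [← ofReal_norm, Real.norm_of_nonneg χ.nonneg, ← ENNReal.ofReal_one]
              exact ENNReal.ofReal_le_ofReal χ.le_one
          _ = ‖curl V x‖ₑ := one_mul _
      · rw [← ofReal_norm, ← ofReal_norm (V x), ← ENNReal.ofReal_mul hK0]
        refine ENNReal.ofReal_le_ofReal ?_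
        calc ‖curlCLM ((fderiv ℝ (χ : E3 → ℝ) x).smulRight (V x))‖
            ≤ ‖(curlCLM : (E3 →L[ℝ] E3) →L[ℝ] E3)‖ * (‖fderiv ℝ (χ : E3 → ℝ) x‖ * ‖V x‖) :=
              norm_curlCLM_smulRight_le _ _
          _ ≤ ‖(curlCLM : (E3 →L[ℝ] E3) →L[ℝ] E3)‖ * (Mχ * ‖V x‖) := by gcongr; exact hMχ x
          _ = K * ‖V x‖ := by rw [hK_def]; ring
    · have hxt : x ∉ tsupport (χ : E3 → ℝ) := by rwa [hχsupp]
      have h0 : (χ : E3 → ℝ) x = 0 := image_eq_zero_of_notMem_tsupport hxt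
      have hD0 : fderiv ℝ (χ : E3 → ℝ) x = 0 := fderiv_of_notMem_tsupport ℝ hxt
      rw [indicator_of_notMem hx, hformula, h0, hD0, zero_smul, zero_add,
        ContinuousLinearMap.zero_smulRight, map_zero, enorm_zero]
  -- pointwise: the divergence of the truncation
  have hdiv_pt : ∀ x, ‖VectorCalculus.divergence u x‖ₑ ≤
      S.indicator (fun x => ENNReal.ofReal Mχ * ‖V x‖ₑ) x := by
    intro x
    have hformula : VectorCalculus.divergence u x = ⟪V x, gradient (χ : E3 → ℝ) x⟫ := by
      rw [hu_def, divergence_smul_apply (hχd x) (hVd x), hdiv x, mul_zero, zero_add]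
    have hinner : ⟪V x, gradient (χ : E3 → ℝ) x⟫ = fderiv ℝ (χ : E3 → ℝ) x (V x) := by
      rw [real_inner_comm, gradient, InnerProductSpace.toDual_symm_apply]
    by_cases hx : x ∈ S
    · rw [indicator_of_mem hx, hformula, hinner, ← ofReal_norm, ← ofReal_norm (V x),
        ← ENNReal.ofReal_mul hMχ0]
      refine ENNReal.ofReal_le_ofReal ?_
      calc ‖fderiv ℝ (χ : E3 → ℝ) x (V x)‖ ≤ ‖fderiv ℝ (χ : E3 → ℝ) x‖ * ‖V x‖ :=
            (fderiv ℝ (χ : E3 → ℝ) x).le_opNorm _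
        _ ≤ Mχ * ‖V x‖ := by gcongr; exact hMχ x
    · have hxt : x ∉ tsupport (χ : E3 → ℝ) := by rwa [hχsupp]
      have hD0 : fderiv ℝ (χ : E3 → ℝ) x = 0 := fderiv_of_notMem_tsupport ℝ hxt
      rw [indicator_of_notMem hx, hformula, hinner, hD0, FunLike.coe_zero, Pi.zero_apply, enorm_zero]
  -- the `q`-th powers, integrated
  have hmc : Measurable fun x => S.indicator (fun x => ‖curl V x‖ₑ + ENNReal.ofReal K * ‖V x‖ₑ) x :=
    ((hcurlVc.measurable.enorm).add (measurable_const.mul hVc.measurable.enorm)).indicator hSm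
  have hN1 : ∫⁻ x, ‖curl u x‖ₑ ^ q ≤ (2 : ℝ≥0∞) ^ (q - 1) * (Ic + ENNReal.ofReal K ^ q * IV) := by
    calc ∫⁻ x, ‖curl u x‖ₑ ^ q
        ≤ ∫⁻ x, (S.indicator (fun x => ‖curl V x‖ₑ + ENNReal.ofReal K * ‖V x‖ₑ) x) ^ q :=
          lintegral_mono fun x => ENNReal.rpow_le_rpow (hcurl_pt x) hq0.le
      _ = ∫⁻ x in S, (‖curl V x‖ₑ + ENNReal.ofReal K * ‖V x‖ₑ) ^ q := by
          rw [← lintegral_indicator hSm]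
          refine lintegral_congr fun x => ?_
          by_cases hx : x ∈ S
          · rw [indicator_of_mem hx, indicator_of_mem hx]
          · rw [indicator_of_notMem hx, indicator_of_notMem hx, ENNReal.zero_rpow_of_pos hq0]
      _ ≤ ∫⁻ x in S, (2 : ℝ≥0∞) ^ (q - 1) * (‖curl V x‖ₑ ^ q + (ENNReal.ofReal K * ‖V x‖ₑ) ^ q) :=
          lintegral_mono fun x => ENNReal.rpow_add_le_mul_rpow_add_rpow _ _ hq1
      _ = (2 : ℝ≥0∞) ^ (q - 1) * (Ic + ENNReal.ofReal K ^ q * IV) := by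
          rw [lintegral_const_mul' _ _ h2top, lintegral_add_left' ((hcurlVc.measurable.enorm.pow_const q).aemeasurable)]
          congr 2
          rw [← lintegral_const_mul' _ _ (ENNReal.rpow_ne_top_of_nonneg hq0.le ENNReal.ofReal_ne_top)]
          refine lintegral_congr fun x => ?_
          rw [ENNReal.mul_rpow_of_nonneg _ _ hq0.le]
  have hN2 : ∫⁻ x, ‖VectorCalculus.divergence u x‖ₑ ^ q ≤ ENNReal.ofReal Mχ ^ q * IV := by
    calc ∫⁻ x, ‖VectorCalculus.divergence u x‖ₑ ^ q
        ≤ ∫⁻ x, (S.indicator (fun x => ENNReal.ofReal Mχ * ‖V x‖ₑ) x) ^ q :=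
          lintegral_mono fun x => ENNReal.rpow_le_rpow (hdiv_pt x) hq0.le
      _ = ∫⁻ x in S, (ENNReal.ofReal Mχ * ‖V x‖ₑ) ^ q := by
          rw [← lintegral_indicator hSm]
          refine lintegral_congr fun x => ?_
          by_cases hx : x ∈ S
          · rw [indicator_of_mem hx, indicator_of_mem hx]
          · rw [indicator_of_notMem hx, indicator_of_notMem hx, ENNReal.zero_rpow_of_pos hq0]
      _ = ENNReal.ofReal Mχ ^ q * IV := by
          rw [← lintegral_const_mul' _ _ (ENNReal.rpow_ne_top_of_nonneg hq0.le ENNReal.ofReal_ne_top)]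
          refine lintegral_congr fun x => ?_
          rw [ENNReal.mul_rpow_of_nonneg _ _ hq0.le]
  -- the global gradient of the truncation
  have hgrad : ∫⁻ x, ‖fderiv ℝ u x‖ₑ ^ q ≤ (Ccz : ℝ≥0∞) ^ q * (2 : ℝ≥0∞) ^ (q - 1) *
      ((∫⁻ x, ‖curl u x‖ₑ ^ q) + ∫⁻ x, ‖VectorCalculus.divergence u x‖ₑ ^ q) := by
    rw [lintegral_rpow_enorm_eq_eLpNorm_rpow _ _ hq0, lintegral_rpow_enorm_eq_eLpNorm_rpow _ _ hq0,
      lintegral_rpow_enorm_eq_eLpNorm_rpow _ _ hq0]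
    calc eLpNorm (fderiv ℝ u) p volume ^ q
        ≤ ((Ccz : ℝ≥0∞) * (eLpNorm (curl u) p volume +
            eLpNorm (VectorCalculus.divergence u) p volume)) ^ q := ENNReal.rpow_le_rpow hcz hq0.le
      _ = (Ccz : ℝ≥0∞) ^ q * (eLpNorm (curl u) p volume +
            eLpNorm (VectorCalculus.divergence u) p volume) ^ q := ENNReal.mul_rpow_of_nonneg _ _ hq0.le
      _ ≤ (Ccz : ℝ≥0∞) ^ q * ((2 : ℝ≥0∞) ^ (q - 1) * (eLpNorm (curl u) p volume ^ q +
            eLpNorm (VectorCalculus.divergence u) p volume ^ q)) := by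
          gcongr; exact ENNReal.rpow_add_le_mul_rpow_add_rpow _ _ hq1
      _ = _ := by ring
  -- `DV = D(χV)` on `B(c, r)`
  have hball : ∫⁻ y in ball c r, ‖fderiv ℝ V y‖ₑ ^ q = ∫⁻ y in ball c r, ‖fderiv ℝ u y‖ₑ ^ q := by
    refine setLIntegral_congr_fun measurableSet_ball fun y hy => ?_
    have hloc : u =ᶠ[𝓝 y] V := by
      filter_upwards [χ.eventuallyEq_one_of_mem_ball hy] with z hz
      simp only [Pi.one_apply] at hz
      show (χ : E3 → ℝ) z • V z = V z
      rw [hz, one_smul]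
    rw [hloc.fderiv_eq]
  -- assemble
  calc ∫⁻ y in ball c r, ‖fderiv ℝ V y‖ₑ ^ q = ∫⁻ y in ball c r, ‖fderiv ℝ u y‖ₑ ^ q := hball
    _ ≤ ∫⁻ y, ‖fderiv ℝ u y‖ₑ ^ q := setLIntegral_le_lintegral _ _
    _ ≤ (Ccz : ℝ≥0∞) ^ q * (2 : ℝ≥0∞) ^ (q - 1) *
        ((∫⁻ x, ‖curl u x‖ₑ ^ q) + ∫⁻ x, ‖VectorCalculus.divergence u x‖ₑ ^ q) := hgrad
    _ ≤ (Ccz : ℝ≥0∞) ^ q * (2 : ℝ≥0∞) ^ (q - 1) *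
        ((2 : ℝ≥0∞) ^ (q - 1) * (Ic + ENNReal.ofReal K ^ q * IV) + ENNReal.ofReal Mχ ^ q * IV) := by
        gcongr
    _ ≤ (Ccz : ℝ≥0∞) ^ q * (2 : ℝ≥0∞) ^ (q - 1) *
        ((2 : ℝ≥0∞) ^ (q - 1) * ((1 + ENNReal.ofReal K ^ q) * (Ic + IV)) +
          ENNReal.ofReal Mχ ^ q * (Ic + IV)) := by
        gcongr
        · calc Ic + ENNReal.ofReal K ^ q * IV ≤ (1 + ENNReal.ofReal K ^ q) * Ic +
                (1 + ENNReal.ofReal K ^ q) * IV := by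
                gcongr
                · calc Ic = 1 * Ic := (one_mul _).symm
                    _ ≤ (1 + ENNReal.ofReal K ^ q) * Ic := by gcongr; exact le_self_add
                · exact le_add_self
            _ = (1 + ENNReal.ofReal K ^ q) * (Ic + IV) := (mul_add _ _ _).symm
        · exact le_add_self
    _ = C * (Ic + IV) := by rw [hC_def, hA_def]; ring

end Summit.NavierStokesRegularity.NavierStokesRegularity.Theorems.Wu2026Salvage

end

-- WHAT THIS IS NOT: not a claim about NS regularity or blow-up; not a claim about any author beyond the typed locator.
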